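import Summits.RiemannHypothesis.RiemannHypothesis.Theses.SignCone
import Literature.NumberTheory.LFunctions.WeilWindowSimpleEven
import Literature.NumberTheory.LFunctions.WeilExplicitProofs

/-!
# `SignCone.SignConeDuality` — line `Sketch` (ratio-induction multipliers), LEAD SKELETON
(crux item stmt-RiemannHypothesis-16304, route route-RiemannHypothesis-SignCone)

CONIC DUALITY AT EACH CUTOFF. Fix `a > 0` and assume the unit-slack sign-cone inequality `X_a`:
for every finite family `g : Fin k → (ℝ → ℂ)` of Weil tests supported in `[-a, a]` whose
autocorrelation sum `F = ∑ i, g i ⋆ (g i)̃` is node-nonnegative (`Re F(log n) ≥ 0`, `n ≥ 2`),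
`Re W_ar(F) ≥ -Re F(0)` where `W_ar = weilPolarTerm + weilArchTerm` is the prime-free Weil form.
Then there is a nonnegative weight `c : ℕ → ℝ`, `c 1 = 0`, with
`Re [W_ar(G) - ∑ₙ c(n) n^{-1/2} (G(log n) + G(-log n))] ≥ -∫ ‖g‖²` for every Weil test `g`
supported in `[-a, a]`, `G = g ⋆ g̃`.

Vocabulary: the item (rev 3) is spelled over Mathlib primitives and is DEFINITIONALLY the
Literature form used below (`IsWeilTest`, `weilConv g (weilReflect g)`, `weilMellin`,
`weilPolarTerm F + weilArchTerm F`; route-repair certificate `SignConeRev3DefEq.lean`, `Iff.rfl`).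

Line (idea `ratio-induction-multipliers`, `Cruxes/SignConeDuality/SketchIdeator1.lean`): the image
of the Weil cone `P(a)` under the moment map `F ↦ (Re W_ar(F) + Re F(0), (Re F(log n))_{2 ≤ n < ⌈e^{2a}⌉})`
is closed under `+` (append families; `W_ar` additive on test kernels) and positive scaling
(`g ↦ √r g`); `X_a` says "node coordinates ≥ 0 ⇒ first coordinate ≥ 0" (far nodes `log n ≥ 2a`
carry `F(log n) = 0`); one nonnegative bump is a Slater point; the topology-free cone-multiplier
engine (`stub_engine`, sInf of ratios, one node at a time) hands out `λ ≥ 0` with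
`∑ λ_n Re G(log n) ≤ Re W_ar(G) + Re G(0)` on the cone; `c(n) := λ_n √n / 2` and the hermitian
symmetry `G(-t) = conj G(t)`, `G(0) = ∫ ‖g‖²` give the conclusion.

Stubs (registered; sorries ONLY here): `stub_engine`, `stub_slater`, `stub_farNode`,
`stub_archPolarAdd`, `stub_scaling`, `stub_multipliers` (lead), `stub_conclusion`.
`SignConeDuality_of` composes them BY NAME and concludes the crux by name.
-/

noncomputable section

open scoped BigOperators ComplexConjugate
open Complex MeasureTheory Set

namespace Summit.RiemannHypothesis.RiemannHypothesis.Theorems.SignConeDuality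

open Literature.NumberTheory.LFunctions

/-! ### Stubs -/

/-- ENGINE (cone multipliers by ratio induction; PROVED in `SketchIdeator1.lean`): for a finite
index type `ι` and `S ⊆ ℝ × ℝ^ι` closed under `+` and positive scaling, if `x.2 ≥ 0 ⇒ x.1 ≥ 0`
on `S` and `S` has a Slater point, then some `l ≥ 0` has `∑ i, l i * x.2 i ≤ x.1` on `S`. -/
theorem stub_engine : ∀ (ι : Type) [Fintype ι] (S : Set (ℝ × (ι → ℝ))),
    (∀ x ∈ S, ∀ y ∈ S, x + y ∈ S) →
    (∀ r : ℝ, 0 < r → ∀ x ∈ S, r • x ∈ S) →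
    (∀ x ∈ S, (∀ i, 0 ≤ x.2 i) → 0 ≤ x.1) →
    (∃ x ∈ S, ∀ i, 0 < x.2 i) →
    ∃ l : ι → ℝ, (∀ i, 0 ≤ l i) ∧ ∀ x ∈ S, ∑ i, l i * x.2 i ≤ x.1 := by
  sorry

/-- SLATER POINT (PROVED in `SketchIdeator1.lean` as `slater_bump`): one smooth bump supported in
`[-a, a]` whose autocorrelation has positive real part at every node `log n < 2a`. -/
theorem stub_slater : ∀ a : ℝ, 0 < a →
    ∃ g : ℝ → ℂ, IsWeilTest g ∧ tsupport g ⊆ Set.Icc (-a) a ∧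
      ∀ n : ℕ, 2 ≤ n → Real.log n < 2 * a →
        0 < (weilConv g (weilReflect g) (Real.log n)).re := by
  sorry

/-- FAR NODES (PROVED in `SketchIdeator1.lean` as `autocorr_eq_zero_of_two_mul_le`): the
autocorrelation of a test supported in `[-a, a]` vanishes at every `t ≥ 2a`. -/
theorem stub_farNode : ∀ (a : ℝ) (g : ℝ → ℂ), IsWeilTest g → tsupport g ⊆ Set.Icc (-a) a →
    ∀ t : ℝ, 2 * a ≤ t → weilConv g (weilReflect g) t = 0 := by
  sorry

/-- ADDITIVITY of the prime-free Weil form on test kernels (PROVED in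
`SketchIdeator1Transport.lean` as `archPolar_add'`: `weilMellin_add`, `weilArchIntegral_add`). -/
theorem stub_archPolarAdd : ∀ F₁ F₂ : ℝ → ℂ, IsWeilTest F₁ → IsWeilTest F₂ →
    weilPolarTerm (F₁ + F₂) + weilArchTerm (F₁ + F₂) =
      (weilPolarTerm F₁ + weilArchTerm F₁) + (weilPolarTerm F₂ + weilArchTerm F₂) := by
  sorry

/-- HOMOGENEITY of the prime-free Weil form (no hypotheses: `weilMellin_const_mul`,
`integral_const_mul`). -/
theorem stub_scaling : ∀ (c : ℂ) (F : ℝ → ℂ),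
    weilPolarTerm (fun t => c * F t) + weilArchTerm (fun t => c * F t) =
      c * (weilPolarTerm F + weilArchTerm F) := by
  sorry

/-- MULTIPLIERS (lead's stub; the instantiation of the engine on the image cone of `P(a)`):
from the engine, the Slater bump, far-node vanishing, additivity and homogeneity, the sign-cone
inequality at cutoff `a` yields `l ≥ 0` on the nodes `2 ≤ n < ⌈e^{2a}⌉` with
`∑ l n · Re G(log n) ≤ Re W_ar(G) + Re G(0)` for every test `g` supported in `[-a, a]`,
`G = g ⋆ g̃`. -/
theorem stub_multipliers :
    (∀ (ι : Type) [Fintype ι] (S : Set (ℝ × (ι → ℝ))),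
      (∀ x ∈ S, ∀ y ∈ S, x + y ∈ S) →
      (∀ r : ℝ, 0 < r → ∀ x ∈ S, r • x ∈ S) →
      (∀ x ∈ S, (∀ i, 0 ≤ x.2 i) → 0 ≤ x.1) →
      (∃ x ∈ S, ∀ i, 0 < x.2 i) →
      ∃ l : ι → ℝ, (∀ i, 0 ≤ l i) ∧ ∀ x ∈ S, ∑ i, l i * x.2 i ≤ x.1) →
    (∀ a : ℝ, 0 < a →
      ∃ g : ℝ → ℂ, IsWeilTest g ∧ tsupport g ⊆ Set.Icc (-a) a ∧
        ∀ n : ℕ, 2 ≤ n → Real.log n < 2 * a →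
          0 < (weilConv g (weilReflect g) (Real.log n)).re) →
    (∀ (a : ℝ) (g : ℝ → ℂ), IsWeilTest g → tsupport g ⊆ Set.Icc (-a) a →
      ∀ t : ℝ, 2 * a ≤ t → weilConv g (weilReflect g) t = 0) →
    (∀ F₁ F₂ : ℝ → ℂ, IsWeilTest F₁ → IsWeilTest F₂ →
      weilPolarTerm (F₁ + F₂) + weilArchTerm (F₁ + F₂) =
        (weilPolarTerm F₁ + weilArchTerm F₁) + (weilPolarTerm F₂ + weilArchTerm F₂)) →
    (∀ (c : ℂ) (F : ℝ → ℂ),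
      weilPolarTerm (fun t => c * F t) + weilArchTerm (fun t => c * F t) =
        c * (weilPolarTerm F + weilArchTerm F)) →
    ∀ a : ℝ, 0 < a →
      (∀ (k : ℕ) (g : Fin k → ℝ → ℂ),
          (∀ i, IsWeilTest (g i) ∧ tsupport (g i) ⊆ Set.Icc (-a) a) →
          (∀ n : ℕ, 2 ≤ n → 0 ≤ (∑ i, weilConv (g i) (weilReflect (g i)) (Real.log n)).re) →
          -(∑ i, weilConv (g i) (weilReflect (g i)) 0).re ≤
            (weilPolarTerm (fun t => ∑ i, weilConv (g i) (weilReflect (g i)) t) +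
              weilArchTerm (fun t => ∑ i, weilConv (g i) (weilReflect (g i)) t)).re) →
      ∃ l : ℕ → ℝ, (∀ n, 0 ≤ l n) ∧
        ∀ g : ℝ → ℂ, IsWeilTest g → tsupport g ⊆ Set.Icc (-a) a →
          ∑ n ∈ Finset.Ico 2 ⌈Real.exp (2 * a)⌉₊,
              l n * (weilConv g (weilReflect g) (Real.log n)).re ≤
            (weilPolarTerm (weilConv g (weilReflect g)) +
                weilArchTerm (weilConv g (weilReflect g))).re +
              (weilConv g (weilReflect g) 0).re := by
  sorry

/-- CONCLUSION (single-`g` bookkeeping): from multipliers `l ≥ 0` on the nodes `2 ≤ n < N` put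
`c n := l n · √n / 2` there and `0` elsewhere; then `c ≥ 0`, `c 1 = 0`, the `∑'` is a finite sum,
`Re (G(log n) + G(-log n)) = 2 Re G(log n)` (`conj_weilConv_weilReflect_neg`) and
`Re G(0) = ∫ ‖g‖²` (`weilConv_weilReflect_apply_zero`). -/
theorem stub_conclusion : ∀ (a : ℝ) (N : ℕ) (l : ℕ → ℝ), (∀ n, 0 ≤ l n) →
    (∀ g : ℝ → ℂ, IsWeilTest g → tsupport g ⊆ Set.Icc (-a) a →
      ∑ n ∈ Finset.Ico 2 N, l n * (weilConv g (weilReflect g) (Real.log n)).re ≤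
        (weilPolarTerm (weilConv g (weilReflect g)) +
            weilArchTerm (weilConv g (weilReflect g))).re +
          (weilConv g (weilReflect g) 0).re) →
    ∃ c : ℕ → ℝ, (∀ n, 0 ≤ c n) ∧ c 1 = 0 ∧
      ∀ g : ℝ → ℂ, IsWeilTest g → tsupport g ⊆ Set.Icc (-a) a →
        -(∫ t, ‖g t‖ ^ 2) ≤
          ((weilPolarTerm (weilConv g (weilReflect g)) +
                weilArchTerm (weilConv g (weilReflect g))) -
            ∑' n : ℕ, ((c n : ℝ) : ℂ) / (Real.sqrt n : ℂ) *
              (weilConv g (weilReflect g) (Real.log n) +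
                weilConv g (weilReflect g) (-Real.log n))).re := by
  sorry

/-! ### The composition (concludes the crux BY NAME) -/

/-- **`SignCone.SignConeDuality`** from the seven stubs: `stub_multipliers` (fed the engine, the
Slater bump, far-node vanishing, additivity and homogeneity) turns the sign-cone inequality at
cutoff `a` into nonnegative node multipliers, and `stub_conclusion` repackages them as the fake
von Mangoldt weight `c`. The item's Mathlib-only spelling is definitionally the Literature
vocabulary, so the hypothesis is passed and the conclusion returned up to `rfl`. -/
theorem SignConeDuality_of :
    Summit.RiemannHypothesis.RiemannHypothesis.Theses.SignCone.SignConeDuality := by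
  intro a ha hX
  obtain ⟨l, hl0, hl⟩ :=
    stub_multipliers stub_engine stub_slater stub_farNode stub_archPolarAdd stub_scaling a ha hX
  exact stub_conclusion a _ l hl0 hl

end Summit.RiemannHypothesis.RiemannHypothesis.Theorems.SignConeDuality

end
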